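import Summits.RiemannHypothesis.RiemannHypothesis.Theorems.SemilocalDeletionDipole
import Literature.NumberTheory.LFunctions.WeilArchimedeanMoments
import HarnessLib

/-!
# The causal filter of a test function and the KMS inequality for its lattice autocorrelations

The engine of the ALL-WINDOW prime-deletion floor `2·log p/(√p + 1)` (`SemilocalDeletionAllWindowFloor.lean`, same seat):
deleting a prime `p` with `m` visible powers from a semi-local Weil form perturbs it by `log p` times the zero-diagonal
Kac–Murdock–Szegő (AR(1)) form `Σ_{d=1}^{m} ρ^d (k(dL) + k(−dL))`, `ρ = 1/√p`, `L = log p`, in the lattice autocorrelations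
`k(dL)` of the test function (`k = g ⋆ g̃`).  This file proves, for EVERY Weil test function `g` on `[−c, c]`, every lag `L > 0`,
every ratio `0 ≤ ρ < 1` and every `m` with `2c < (m+1)L` (so that `k` vanishes at the lags `(m+1)L, (m+2)L, …`):

  `kms_autocorrelation_floor`:  `Σ_{d=1}^{m} ρ^d·Re(k(dL) + k(−dL)) ≥ −(2ρ/(1+ρ))·‖g‖₂²`

— the infimum `(1−ρ)/(1+ρ) − 1` of the KMS symbol `(1−ρ²)/(1 − 2ρ cos θ + ρ²) − 1` (at `θ = π`).  The proof uses NO fibre/cell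
decomposition of the window and no Fourier analysis: the CAUSAL FILTER is applied to the test function itself,

  `U_D(t) = Σ_{j=0}^{D} ρ^j g(t − jL)`  (§1; a Weil test function),
  `‖U_{D+1}‖₂² = ‖g‖₂² + 2ρ·Re Σ_{j≤D} ρ^j k((j+1)L) + ρ²‖U_D‖₂²`  (§2, peeling the first term),
  `‖g‖₂² ≤ ‖U_D − ρ·U_D(· − L)‖₂² ≤ (1+ρ)²‖U_D‖₂²` once `(D+1)L > 2c`  (§3: telescoping `U_D − ρU_D(·−L) = g − ρ^{D+1}g(· − (D+1)L)`,
  disjoint supports, Peter–Paul),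

so along `D = m + n` the energies obey the affine recursion `β_{n+1} = T + ρ²β_n` with `T = ‖g‖₂² + Σ_{d≤m} ρ^d Re(k(dL) + k(−dL))`
and stay `≥ ‖g‖₂²/(1+ρ)²`; the recursion converges to `T/(1−ρ²)`, whence `T ≥ ((1−ρ)/(1+ρ))‖g‖₂²` (§4, `affine_recursion_bound`).
(The fibre route — finite KMS sections `[ρ^{|i−j|}]_{i,j≤m} ⪰ (1−ρ)/(1+ρ)` on the cells `[−c + iL, −c + (i+1)L)` — is the desk file
`SemilocalDeletionToeplitzFloorUniform` of cc-s2-1 gen12, behind the unbuilt `SemilocalDeletionToeplitzFloor`; this file imports built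
modules only.)

Nothing here bears on RH; these are statements about test functions.  [KMS: M. Kac, W. L. Murdock, G. Szegő, *On the eigenvalues
of certain Hermitian forms*, J. Rational Mech. Anal. 2 (1953) — used only as a name for the weights `ρ^{|d|}`.]
-/

set_option linter.dupNamespace false

noncomputable section

open Complex Filter Set MeasureTheory
open scoped Real Topology ComplexConjugate

namespace Summit.RiemannHypothesis.RiemannHypothesis.Theorems.SemilocalDeletionCausalFilter

open Literature.NumberTheory.LFunctions
open Summit.RiemannHypothesis.RiemannHypothesis.Theorems.SemilocalDeletionCliff
open Summit.RiemannHypothesis.RiemannHypothesis.Theorems.SemilocalDeletionDipole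

variable {g : ℝ → ℂ}

/-! ## §0  Three pointwise facts and one fact about affine recursions -/

/-- Pointwise expansion `‖a + ρ·b‖² = ‖a‖² + ρ²‖b‖² + 2ρ·Re(a·conj b)` for real `ρ`. -/
theorem norm_sq_add_real_mul (a b : ℂ) (ρ : ℝ) :
    ‖a + (ρ : ℂ) * b‖ ^ 2 = ‖a‖ ^ 2 + ρ ^ 2 * ‖b‖ ^ 2 + 2 * ρ * (a * conj b).re := by
  rw [← Complex.normSq_eq_norm_sq, ← Complex.normSq_eq_norm_sq, ← Complex.normSq_eq_norm_sq, Complex.normSq_add,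
    Complex.normSq_mul, Complex.normSq_ofReal, map_mul, Complex.conj_ofReal]
  have : (a * ((ρ : ℂ) * conj b)).re = ρ * (a * conj b).re := by
    rw [show a * ((ρ : ℂ) * conj b) = (ρ : ℂ) * (a * conj b) by ring, Complex.re_ofReal_mul]
  rw [this]
  ring

/-- Peter–Paul: `‖a − ρ·b‖² ≤ (1+ρ)‖a‖² + ρ(1+ρ)‖b‖²` for `ρ ≥ 0`. -/
theorem norm_sq_sub_real_mul_le (a b : ℂ) {ρ : ℝ} (hρ : 0 ≤ ρ) :
    ‖a - (ρ : ℂ) * b‖ ^ 2 ≤ (1 + ρ) * ‖a‖ ^ 2 + ρ * (1 + ρ) * ‖b‖ ^ 2 := by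
  have h1 : ‖a - (ρ : ℂ) * b‖ ≤ ‖a‖ + ρ * ‖b‖ := by
    calc ‖a - (ρ : ℂ) * b‖ ≤ ‖a‖ + ‖(ρ : ℂ) * b‖ := norm_sub_le _ _
      _ = ‖a‖ + ρ * ‖b‖ := by rw [norm_mul, Complex.norm_real, Real.norm_eq_abs, abs_of_nonneg hρ]
  have h2 : 0 ≤ ‖a - (ρ : ℂ) * b‖ := norm_nonneg _
  have h3 : ‖a - (ρ : ℂ) * b‖ ^ 2 ≤ (‖a‖ + ρ * ‖b‖) ^ 2 := pow_le_pow_left₀ h2 h1 2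
  nlinarith [two_mul_le_add_sq ‖a‖ ‖b‖, norm_nonneg a, norm_nonneg b]

/-- If `tsupport g ⊆ [−c, c]` and `2c < X` then `g(t)` and `g(t − X)` are never both nonzero, so
`‖g(t)‖² ≤ ‖g(t) − z·g(t − X)‖²` for any `z`. -/
theorem norm_sq_le_norm_sq_sub_mul_shift {c X : ℝ} (hsupp : tsupport g ⊆ Icc (-c) c) (hX : 2 * c < X) (z : ℂ) (t : ℝ) :
    ‖g t‖ ^ 2 ≤ ‖g t - z * g (t - X)‖ ^ 2 := by
  by_cases h0 : g t = 0
  · rw [h0, norm_zero, zero_pow two_ne_zero]; positivity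
  · have ht := hsupp (subset_tsupport _ (Function.mem_support.2 h0))
    rw [mem_Icc] at ht
    have h1 : g (t - X) = 0 := by
      by_contra hne
      have ht' := hsupp (subset_tsupport _ (Function.mem_support.2 hne))
      rw [mem_Icc] at ht'
      linarith [ht.2, ht'.1]
    rw [h1, mul_zero, sub_zero]

/-- Fixed-point lemma for the affine recursion `β_{n+1} = T + ρ²β_n` (`0 ≤ ρ < 1`): if `N ≤ C·β_n` for all `n`, then
`(1 − ρ²)·N ≤ C·T` (the iterates converge geometrically to `T/(1 − ρ²)`). -/
theorem affine_recursion_bound {ρ T N C : ℝ} (β : ℕ → ℝ) (hρ0 : 0 ≤ ρ) (hρ1 : ρ < 1)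
    (hrec : ∀ n, β (n + 1) = T + ρ ^ 2 * β n) (hlow : ∀ n, N ≤ C * β n) :
    (1 - ρ ^ 2) * N ≤ C * T := by
  have hq0 : 0 ≤ ρ ^ 2 := by positivity
  have hq1 : ρ ^ 2 < 1 := by nlinarith
  have h1q : 0 < 1 - ρ ^ 2 := by linarith
  set βs : ℝ := T / (1 - ρ ^ 2) with hβs
  have hT : T = (1 - ρ ^ 2) * βs := by rw [hβs]; field_simp
  have hδ : ∀ n, β n - βs = (ρ ^ 2) ^ n * (β 0 - βs) := by
    intro n
    induction n with
    | zero => simp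
    | succ n ih => rw [hrec n, pow_succ, hT]; linear_combination (ρ ^ 2) * ih
  by_contra hlt
  push Not at hlt
  -- `C·βs < N`
  have hgap : C * βs < N := by
    have : C * T = (1 - ρ ^ 2) * (C * βs) := by rw [hT]; ring
    rw [this] at hlt
    exact lt_of_mul_lt_mul_left hlt h1q.le
  set ε : ℝ := N - C * βs with hε
  have hε0 : 0 < ε := by rw [hε]; linarith
  have hstep : ∀ n, ε ≤ C * (β 0 - βs) * (ρ ^ 2) ^ n := by
    intro n
    have h := hlow n
    have : β n = βs + (ρ ^ 2) ^ n * (β 0 - βs) := by linarith [hδ n]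
    rw [this] at h
    rw [hε]
    linarith
  have hK : 0 < C * (β 0 - βs) := by
    have := hstep 0
    rw [pow_zero, mul_one] at this
    linarith
  obtain ⟨n, hn⟩ := exists_pow_lt_of_lt_one (div_pos hε0 hK) hq1
  have := hstep n
  have h2 : C * (β 0 - βs) * (ρ ^ 2) ^ n < ε := by
    have := mul_lt_mul_of_pos_left hn hK
    rwa [mul_div_cancel₀ _ hK.ne'] at this
  linarith

/-- `k(x) + k(−x)` is real with real part `2·Re k(x)` (`k = g ⋆ g̃` is self-adjoint: `conj k(−x) = k(x)`). -/
theorem re_weilConv_weilReflect_add_neg (g : ℝ → ℂ) (x : ℝ) :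
    (weilConv g (weilReflect g) x + weilConv g (weilReflect g) (-x)).re = 2 * (weilConv g (weilReflect g) x).re := by
  have h := conj_weilConv_weilReflect_neg g x
  have : (weilConv g (weilReflect g) (-x)).re = (weilConv g (weilReflect g) x).re := by
    rw [← h, Complex.conj_re]
  rw [Complex.add_re, this]
  ring


/-! ## §1  The truncated causal filter `U_D = Σ_{j ≤ D} ρ^j·g(· − jL)`

To keep this a proof file (no new definitions), the filter is a hypothesis `hU : ∀ D t, U D t = Σ_{j ≤ D} ρ^j g(t − jL)` on a family
`U : ℕ → ℝ → ℂ`, discharged by `rfl` in §4. -/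

section Filter

variable {ρ L : ℝ} {U : ℕ → ℝ → ℂ}
  (hU : ∀ (D : ℕ) (t : ℝ), U D t = ∑ j ∈ Finset.range (D + 1), ((ρ : ℂ) ^ j) * g (t - j * L))
include hU

/-- `U_0 = g`. -/
theorem causalFilter_zero : U 0 = g := by
  funext t
  simp [hU]

/-- Peeling the first term: `U_{D+1}(t) = g(t) + ρ·U_D(t − L)`. -/
theorem causalFilter_succ_apply (D : ℕ) (t : ℝ) : U (D + 1) t = g t + (ρ : ℂ) * U D (t - L) := by
  rw [hU, hU, Finset.sum_range_succ', Finset.mul_sum, add_comm]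
  congr 1
  · simp
  · refine Finset.sum_congr rfl fun j _ ↦ ?_
    have : t - L - (j : ℝ) * L = t - ((j + 1 : ℕ) : ℝ) * L := by push_cast; ring
    rw [this, pow_succ]
    ring

/-- Telescoping: `U_D(t) − ρ·U_D(t − L) = g(t) − ρ^{D+1} g(t − (D+1)L)`. -/
theorem causalFilter_sub_mul_shift (D : ℕ) (t : ℝ) :
    U D t - (ρ : ℂ) * U D (t - L) = g t - (ρ : ℂ) ^ (D + 1) * g (t - (D + 1) * L) := by
  have h := causalFilter_succ_apply hU D t
  -- `U_{D+1}(t) = U_D(t) + ρ^{D+1} g(t − (D+1)L)` by the last term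
  have h' : U (D + 1) t = U D t + (ρ : ℂ) ^ (D + 1) * g (t - (D + 1) * L) := by
    rw [hU, hU, Finset.sum_range_succ]
    push_cast
    rfl
  linear_combination h - h'

/-- The causal filter of a test function is a test function. -/
theorem isWeilTest_causalFilter (hg : IsWeilTest g) (D : ℕ) : IsWeilTest (U D) := by
  induction D with
  | zero => rw [causalFilter_zero hU]; exact hg
  | succ D ih =>
    have h := hg.add ((ih.weilTranslate L).const_mul (ρ : ℂ))
    convert h using 1
    funext t
    rw [causalFilter_succ_apply hU]
    simp [weilTranslate]

/-! ## §2  The energy recursion `‖U_{D+1}‖² = ‖g‖² + 2ρ·Re Σ_{j≤D} ρ^j k((j+1)L) + ρ²‖U_D‖²` -/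

/-- `∫ g(t)·conj U_D(t − L) dt = Σ_{j ≤ D} ρ^j · k((j+1)L)` with `k = g ⋆ g̃` (`k(x) = ∫ g(u) conj g(u − x) du`). -/
theorem integral_mul_conj_causalFilter_shift (hg : IsWeilTest g) (D : ℕ) :
    ∫ t : ℝ, g t * conj (U D (t - L)) =
      ∑ j ∈ Finset.range (D + 1), ((ρ : ℂ) ^ j) * weilConv g (weilReflect g) ((j + 1) * L) := by
  have hterm : ∀ j : ℕ, Integrable fun t : ℝ ↦ g t * (((ρ : ℂ) ^ j) * conj (g (t - L - j * L))) := fun j ↦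
    hg.integrable_mul (continuous_const.mul
      ((Complex.continuous_conj.comp (hg.1.continuous.comp ((continuous_id.sub continuous_const).sub
        continuous_const)))))
  have hpt : ∀ t : ℝ, g t * conj (U D (t - L)) =
      ∑ j ∈ Finset.range (D + 1), g t * (((ρ : ℂ) ^ j) * conj (g (t - L - j * L))) := by
    intro t
    simp only [hU, map_sum, map_mul, map_pow, Complex.conj_ofReal, Finset.mul_sum]
  simp_rw [hpt]
  rw [integral_finsetSum _ fun j _ ↦ hterm j]
  refine Finset.sum_congr rfl fun j _ ↦ ?_
  rw [weilConv_weilReflect_apply' g _, ← integral_const_mul]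
  refine integral_congr_ae (Eventually.of_forall fun t ↦ ?_)
  have : t - L - (j : ℝ) * L = t - (j + 1) * L := by ring
  dsimp only
  rw [this]
  ring

/-- **Energy recursion.** `‖U_{D+1}‖₂² = ‖g‖₂² + ρ²‖U_D‖₂² + 2ρ·Re Σ_{j ≤ D} ρ^j k((j+1)L)`. -/
theorem integral_norm_sq_causalFilter_succ (hg : IsWeilTest g) (D : ℕ) :
    ∫ t : ℝ, ‖U (D + 1) t‖ ^ 2 =
      (∫ t : ℝ, ‖g t‖ ^ 2) + ρ ^ 2 * (∫ t : ℝ, ‖U D t‖ ^ 2) +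
        2 * ρ * (∑ j ∈ Finset.range (D + 1), ((ρ : ℂ) ^ j) * weilConv g (weilReflect g) ((j + 1) * L)).re := by
  have hUt := isWeilTest_causalFilter hU hg D
  have h1 : Integrable fun t : ℝ ↦ ‖g t‖ ^ 2 := hg.integrable_norm_sq
  have h2 : Integrable fun t : ℝ ↦ ρ ^ 2 * ‖U D (t - L)‖ ^ 2 := (hUt.integrable_norm_sq.comp_sub_right L).const_mul _
  have h3c : Integrable fun t : ℝ ↦ g t * conj (U D (t - L)) :=
    hg.integrable_mul (Complex.continuous_conj.comp (hUt.1.continuous.comp (continuous_id.sub continuous_const)))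
  have h3 : Integrable fun t : ℝ ↦ 2 * ρ * (g t * conj (U D (t - L))).re := h3c.re.const_mul _
  have h12 : Integrable fun t : ℝ ↦ ‖g t‖ ^ 2 + ρ ^ 2 * ‖U D (t - L)‖ ^ 2 := h1.add h2
  simp_rw [causalFilter_succ_apply hU, norm_sq_add_real_mul]
  rw [integral_add h12 h3, integral_add h1 h2, integral_const_mul, integral_const_mul,
    integral_sub_right_eq_self (fun t : ℝ ↦ ‖U D t‖ ^ 2) L]
  congr 1
  rw [← integral_mul_conj_causalFilter_shift hU hg D]
  have := integral_re h3c
  simp only [RCLike.re_to_complex] at this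
  rw [this]

/-! ## §3  The lower bound `‖g‖² ≤ (1 + ρ)²·‖U_D‖²` once `(D+1)L` exceeds the window -/

/-- **Lower bound.** For `0 ≤ ρ`, `tsupport g ⊆ [−c, c]` and `2c < (D+1)L`: `‖g‖₂² ≤ (1 + ρ)²·‖U_D‖₂²`. -/
theorem integral_norm_sq_le_causalFilter (hg : IsWeilTest g) {c : ℝ} (hsupp : tsupport g ⊆ Icc (-c) c) (hρ : 0 ≤ ρ)
    {D : ℕ} (hD : 2 * c < (D + 1) * L) :
    ∫ t : ℝ, ‖g t‖ ^ 2 ≤ (1 + ρ) ^ 2 * ∫ t : ℝ, ‖U D t‖ ^ 2 := by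
  have hUt := isWeilTest_causalFilter hU hg D
  have hi1 : Integrable fun t : ℝ ↦ (1 + ρ) * ‖U D t‖ ^ 2 := hUt.integrable_norm_sq.const_mul _
  have hi2 : Integrable fun t : ℝ ↦ ρ * (1 + ρ) * ‖U D (t - L)‖ ^ 2 := (hUt.integrable_norm_sq.comp_sub_right L).const_mul _
  have hpt : ∀ t : ℝ, ‖g t‖ ^ 2 ≤ (1 + ρ) * ‖U D t‖ ^ 2 + ρ * (1 + ρ) * ‖U D (t - L)‖ ^ 2 := by
    intro t
    have h1 := norm_sq_le_norm_sq_sub_mul_shift hsupp hD ((ρ : ℂ) ^ (D + 1)) t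
    rw [← causalFilter_sub_mul_shift hU] at h1
    exact h1.trans (norm_sq_sub_real_mul_le _ _ hρ)
  calc ∫ t : ℝ, ‖g t‖ ^ 2
      ≤ ∫ t : ℝ, (1 + ρ) * ‖U D t‖ ^ 2 + ρ * (1 + ρ) * ‖U D (t - L)‖ ^ 2 :=
        integral_mono hg.integrable_norm_sq (hi1.add hi2) hpt
    _ = (1 + ρ) * (∫ t : ℝ, ‖U D t‖ ^ 2) + ρ * (1 + ρ) * ∫ t : ℝ, ‖U D t‖ ^ 2 := by
        rw [integral_add hi1 hi2, integral_const_mul, integral_const_mul,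
          integral_sub_right_eq_self (fun t : ℝ ↦ ‖U D t‖ ^ 2) L]
    _ = (1 + ρ) ^ 2 * ∫ t : ℝ, ‖U D t‖ ^ 2 := by ring

end Filter

/-! ## §4  The KMS inequality for autocorrelations: `Σ_{d=1}^{m} ρ^d (k(dL) + k(−dL)) ≥ −(2ρ/(1+ρ))‖g‖²` -/

/-- **KMS INEQUALITY FOR AUTOCORRELATIONS.** For a Weil test function `g` on `[−c, c]`, a lag `L > 0`, a ratio `0 ≤ ρ < 1`
and `m` with `2c < (m+1)L` (so that `k = g ⋆ g̃` vanishes at the lags `(m+1)L, (m+2)L, …`):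
`Σ_{d=1}^{m} ρ^d·(k(dL) + k(−dL)) ≥ −(2ρ/(1+ρ))·‖g‖₂²` — the infimum `(1−ρ)/(1+ρ) − 1` of the symbol
`Σ_{d∈ℤ} ρ^{|d|} e^{idθ} − 1` of the Kac–Murdock–Szegő (AR(1)) Toeplitz operator, attained at `θ = π`.  Proof: causal filter
`U_D = Σ_{j≤D} ρ^j g(· − jL)`; `‖g‖₂² ≤ (1+ρ)²‖U_D‖₂²` (§3) and `‖U_{D+1}‖₂² = ‖g‖₂² + 2ρ·Re Σ ρ^j k((j+1)L) + ρ²‖U_D‖₂²` (§2), then `D → ∞`. -/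
theorem kms_autocorrelation_floor (hg : IsWeilTest g) {c L ρ : ℝ} (hsupp : tsupport g ⊆ Icc (-c) c) (hL : 0 < L)
    (hρ0 : 0 ≤ ρ) (hρ1 : ρ < 1) {m : ℕ} (hm : 2 * c < (m + 1) * L) :
    -(2 * ρ / (1 + ρ)) * ∫ t : ℝ, ‖g t‖ ^ 2 ≤
      ∑ j ∈ Finset.range m, ρ ^ (j + 1) *
        (weilConv g (weilReflect g) ((j + 1) * L) + weilConv g (weilReflect g) (-((j + 1) * L))).re := by
  set k := weilConv g (weilReflect g) with hkdef
  set N : ℝ := ∫ t : ℝ, ‖g t‖ ^ 2 with hN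
  set U : ℕ → ℝ → ℂ := fun D t ↦ ∑ j ∈ Finset.range (D + 1), ((ρ : ℂ) ^ j) * g (t - j * L) with hUdef
  have hU : ∀ (D : ℕ) (t : ℝ), U D t = ∑ j ∈ Finset.range (D + 1), ((ρ : ℂ) ^ j) * g (t - j * L) := fun _ _ ↦ rfl
  set β : ℕ → ℝ := fun D ↦ ∫ t : ℝ, ‖U D t‖ ^ 2 with hβ
  set A : ℝ := (∑ j ∈ Finset.range m, ((ρ : ℂ) ^ j) * k ((j + 1) * L)).re with hA
  -- the lags beyond the window do not contribute
  have hvan : ∀ j : ℕ, m ≤ j → k ((j + 1) * L) = 0 := by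
    intro j hj
    refine weilConv_weilReflect_eq_zero_of_lt hg hsupp ?_
    have hj' : (m : ℝ) + 1 ≤ (j : ℝ) + 1 := by exact_mod_cast Nat.succ_le_succ hj
    rw [abs_of_nonneg (by positivity)]
    calc 2 * c < (m + 1) * L := hm
      _ ≤ (j + 1) * L := mul_le_mul_of_nonneg_right hj' hL.le
  have hAn : ∀ n : ℕ, (∑ j ∈ Finset.range (m + n + 1), ((ρ : ℂ) ^ j) * k ((j + 1) * L)).re = A := by
    intro n
    rw [hA, show m + n + 1 = m + (n + 1) from rfl, Finset.sum_range_add]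
    have : ∑ x ∈ Finset.range (n + 1), ((ρ : ℂ) ^ (m + x)) * k ((((m + x : ℕ) : ℝ) + 1) * L) = 0 := by
      refine Finset.sum_eq_zero fun x _ ↦ ?_
      rw [hvan (m + x) (Nat.le_add_right m x), mul_zero]
    rw [this, add_zero]
  -- the recursion and the lower bound along `D = m + n`
  set T : ℝ := N + 2 * ρ * A with hT
  have hrec : ∀ n : ℕ, β (m + (n + 1)) = T + ρ ^ 2 * β (m + n) := by
    intro n
    have h := integral_norm_sq_causalFilter_succ hU hg (m + n)
    rw [← hkdef, hAn n] at h
    show (∫ t : ℝ, ‖U (m + n + 1) t‖ ^ 2) = T + ρ ^ 2 * ∫ t : ℝ, ‖U (m + n) t‖ ^ 2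
    rw [h, hT, hN]
    ring
  have hlow : ∀ n : ℕ, N ≤ (1 + ρ) ^ 2 * β (m + n) := by
    intro n
    have hD : 2 * c < ((m + n : ℕ) + 1) * L := by
      have : (m : ℝ) + 1 ≤ ((m + n : ℕ) : ℝ) + 1 := by push_cast; linarith [(Nat.cast_nonneg n : (0 : ℝ) ≤ n)]
      exact hm.trans_le (mul_le_mul_of_nonneg_right this hL.le)
    exact integral_norm_sq_le_causalFilter hU hg hsupp hρ0 hD
  have hfp := affine_recursion_bound (fun n ↦ β (m + n)) hρ0 hρ1 hrec hlow
  -- the target sum is `2ρ·A`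
  have hsum : ∑ j ∈ Finset.range m, ρ ^ (j + 1) * (k ((j + 1) * L) + k (-((j + 1) * L))).re = 2 * ρ * A := by
    rw [hA, Complex.re_sum, Finset.mul_sum]
    refine Finset.sum_congr rfl fun j _ ↦ ?_
    rw [hkdef, re_weilConv_weilReflect_add_neg, ← Complex.ofReal_pow, Complex.re_ofReal_mul, pow_succ]
    ring
  rw [hsum]
  have h1ρ : 0 < 1 + ρ := by linarith
  have key : -(2 * ρ * (1 + ρ) * N) ≤ 2 * ρ * A * (1 + ρ) ^ 2 := by
    have : (1 + ρ) ^ 2 * T = (1 + ρ) ^ 2 * N + 2 * ρ * A * (1 + ρ) ^ 2 := by rw [hT]; ring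
    nlinarith [hfp, this]
  calc -(2 * ρ / (1 + ρ)) * N = -(2 * ρ * (1 + ρ) * N) / (1 + ρ) ^ 2 := by field_simp
    _ ≤ 2 * ρ * A := (div_le_iff₀ (by positivity)).2 key


end Summit.RiemannHypothesis.RiemannHypothesis.Theorems.SemilocalDeletionCausalFilter

end
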